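import Literature.Geometry.ComplexHyperbolic.UnitBallHyperboloidChart        -- ★ `bergmanVolume_eq_smul_map_chart`, `coe_proj_vecCons_sqrt`, `one_sub_nsq_inv_sqrt_one_add_nsq_smul`, `continuous_chart`
import Literature.AlgebraicGeometry.ShimuraVarieties.UnitaryBallGroupIntegral -- ★ `map_orbit_haar_eq_smul_bergmanVolume`, `bergmanVolume`
import Literature.Geometry.ComplexHyperbolic.UnitBallBounds                  -- ★ `one_sub_nsq_smul_x₀`, `one_le_norm_22`
import Literature.NumberTheory.Automorphic.UnitaryGroupFormTransport         -- ★ `unitaryGroupOfForm`, `GLn.conjEquiv`, `ContinuousMulEquiv.restrictSubgroup`, `conj_mem_unitaryGroupOfForm_iff`, `formCongr_star`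
import Literature.NumberTheory.Rogawski1990.ArchHyperbolicOrbitHSBall        -- ★ `hs_unitary_conj` (HS is invariant under unitary conjugation, any size)
import Mathlib.MeasureTheory.Measure.Lebesgue.EqHaar
import Mathlib.MeasureTheory.Measure.Haar.Unique
import HarnessLib

/-!
# Quadratic growth of the Haar volume of Hilbert–Schmidt balls in `U(2,1)`, UNCONDITIONAL — read off the tree's ball model `U(2,1) ↷ 𝔹²`
# ((T3-out-G): the `G_∞`-side twin of (T2-out); Beuzart-Plessis 2020 §1.5 (1.5.2)–(1.5.3), Rudin 1980 §2.2, Helgason 2000 Ch. I Thm. 1.9)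

Topic `NumberTheory/Rogawski1990`; namespace `Literature.NumberTheory.Rogawski1990`.  THEOREMS ONLY (no definition, no instance, no notation, no axiom, no named
fact, no `sorry`).  Cell `pub/hodgecm-mathlib`, crux H413 (`stmt-HodgeConjecture-24833`), F0∕P3c line LH2 (closer stub `stub_N8`, pay-down leaf
`Cruxes/H413/Lines/F0_P3c_ArchInnerTransferPaydown.lean` ED. 2; residue = the LETTERS O1″ `stub_N8schwartz` [Shelstad 1979 Thm. 4.1] and O3″ `stub_N8bouaziz`
[Bouaziz 1994 Thm. 6.2.1 (i)], both about the Harish-Chandra Schwartz class `ArchSchwartzOn L 3 Φ₃ 1` of `G_∞ = U(Φ₃)(L⁺ ⊗ ℝ) ≅ U(2,1)^d`); seat LH2-p01 (g3), brick (T3-out-G)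
(offer 2026-09-02T04:09:45Z, LH2-plan (g0) «GO» 04:10:08Z); lane `--supports stmt-HodgeConjecture-24833`.  COUNT-NEUTRAL (VOL)-kit: it restates no clause of (14.2.1) and opens no vocabulary.

THE THEOREM.  For every Haar measure `ν` on `U(Φ₃)(ℂ)` (`Φ₃ = antidiag(1,1,1)`, the cell's form, signature `(2,1)`):
  `ν {g ∣ Σ_{ij} |g_{ij}|² ≤ ρ} ≤ C · ρ²`  for all `ρ ≥ 1`                                  (`haar_unitaryGroupOfForm_antidiag_three_hsBall_le_quadratic`),
the `U(2,1)`-twin of LH3-p02's ★ `haar_unitaryGroupOfForm_antidiag_two_hsBall_le_linear` (`U(1,1)`: linear growth, via `S¹ × SL₂(ℝ)` and Mathlib's measure on `ℍ`).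
It is Harish-Chandra's polynomial growth of balls [BeuzartPlessis2020Asterisque, §1.5 (1.5.2)–(1.5.3)] for the real-rank-one group `U(2,1)` at the scale `e = 1`
of ★ `ArchSchwartzOn L 3 Φ₃ 1` (`Ξ(a_t)⁻¹ ≍ e^{2t} ≍ ‖a_t‖²_HS`, Haar density `≍ e^{4t} dt`): the GROUP-side token `hgrp` which, together with an orbit-versus-group
comparison at a regular elliptic class (LH2-p02's (B′) `ArchEllipticOrbitHSBallThree`), feeds ★ `integrable_orbitalIntegrand_of_archSchwartzGL_of_isQuotientOf`
(p848739): convergence of the Schwartz orbital integrals that the two LH2 letters integrate.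

THE PROOF USES NO COORDINATES ON `U(2,1)`.  The tree's ball-model library `Literature/Geometry/ComplexHyperbolic/UnitBall*` (the uniformisation cell of the Picard
modular surface) already holds: the group `U21 = {g ∣ gᴴ J g = J}`, `J = diag(1,1,−1)`, acting on `𝔹² ⊂ ℂ²` with base point `x₀ = 0`; ★ `one_sub_nsq_smul_x₀`
(`1 − |g·x₀|² = |g₂₂|⁻²`); the Bergman volume `β = 9(1−|z|²)⁻³ dv` and ★ `map_orbit_haar_eq_smul_bergmanVolume` (`(g ↦ g·x₀)_* μ = c · β`, `0 < c < ∞`, for EVERY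
Haar `μ` — Helgason's uniqueness of the invariant measure on `G∕K`); and ★ `bergmanVolume_eq_smul_map_chart` (`β = 9 · chart_* vol_{ℂ²}` for the hyperboloid chart
`W ↦ (1+|W|²)^{-1∕2} W`, under which `1 − |z|² = (1+|W|²)⁻¹`).  Hence
  `{Σ|g_{ij}|² ≤ ρ} ⊆ {|g₂₂|² ≤ ρ} = π⁻¹{z ∣ 1 − |z|² ≥ ρ⁻¹}`,  `β{1 − |z|² ≥ ρ⁻¹} = 9 · vol_{ℂ²}{W ∣ 1 + |W|² ≤ ρ} ≤ 9 · vol(B̄(0, √ρ)) = 9 V₁ ρ²`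
(`dim_ℝ ℂ² = 4`, `Measure.addHaar_closedBall`), so `μ{Σ|g_{ij}|² ≤ ρ} ≤ 9 c V₁ · ρ²` on `U21` (`haar_U21_hsBall_le_quadratic`).  The transport to the cell's carrier
`U(Φ₃)(ℂ) = unitaryGroupOfForm (starRingEnd ℂ) Φ₃` is the conjugation `g ↦ T g T⁻¹` by the real orthogonal involution `T = 2^{-1∕2}·(1,0,1; 0,√2,0; 1,0,−1)`
(`Tᴴ J T = Φ₃`, ★ `ContinuousMulEquiv.restrictSubgroup (GLn.conjEquiv T)`), which carries Haar measures to Haar measures (`ContinuousMulEquiv.isHaarMeasure_map`) and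
preserves `Σ|g_{ij}|²` (★ `hs_unitary_conj`).  (The exact value is `ν{Σ|g_{ij}|² ≤ ρ} = (9π²c∕32)(ρ−3)²` for `ρ ≥ 3`, since `Σ|g_{ij}|² = 4|g₂₂|² − 1` on `U(2,1)`;
only the upper bound is typed.)

* §1 `inv_le_one_sub_nsq_smul_x₀_of_hs_le`, `nsq_le_of_inv_le_one_sub_nsq_chart` (+ private plumbing `sq_norm_apply_le_hs`, `setOf_nsq_le_subset_closedBall`,
  `finrank_real_fin_two_complex`, `volume_setOf_nsq_le_le`) — the inclusions ∕ volumes above;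
* §2 **`haar_U21_hsBall_le_quadratic`** — the theorem on the ball-model group `U21`;
* §3 `mem_U21_iff_mem_unitaryGroupOfForm_J`, `exists_unitary_formCongr_J_eq_antidiag_three` (private: `conjTranspose_mul_self_sylvesterT`, `conjTranspose_sylvesterT_mul_J_mul`),
  `haar_unitaryGroupOfForm_hsBall_le_of_unitary_formCongr` (transport along ANY unitary `T` with `Tᴴ J T = H`), and the head
  **`haar_unitaryGroupOfForm_antidiag_three_hsBall_le_quadratic`** (token shape of ★ (T2-out): `Φ₃ = Matrix.of (i+j+1 = 3)`, any `[MeasurableSpace] [BorelSpace]`, any Haar `ν`).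
HONEST LABEL: HC_CM is proved only modulo the 7 printed citations (2 remaining: hLiu418 = `stmt-HodgeConjecture-24832`, h413 = `stmt-HodgeConjecture-24833`) until rung 0
closes; this file is (VOL)-kit under the LH2 letters O1″∕O3″ and pays no printed row.

## References
* [BeuzartPlessis2020Asterisque] R. Beuzart-Plessis, *A local trace formula for the Gan–Gross–Prasad conjecture for unitary groups: the archimedean case*, Astérisque 418
  (2020), §1.5 (1.5.2)–(1.5.3) p. 31 (polynomial growth of balls; convergence of `∫ Ξ (1+σ)^{-d}`).
* [Rudin1980] W. Rudin, *Function Theory in the Unit Ball of ℂⁿ*, Grundlehren 241 (1980), §2.2 Thm. 2.2.6 (the invariant measure `(1−|z|²)^{-(n+1)} dν`), §1.4.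
* [Helgason2000] S. Helgason, *Groups and Geometric Analysis*, AMS (2000), Ch. I §1 No. 2, Thm. 1.9 (uniqueness of the invariant measure on `G∕K`).
* [Rogawski1990] J. D. Rogawski, *Automorphic Representations of Unitary Groups in Three Variables*, Ann. of Math. Stud. 123 (1990), §14.2 (14.2.1) pp. 232–233; §3.6 p. 31.
-/

set_option autoImplicit false

noncomputable section

open MeasureTheory MeasureTheory.Measure Set
open Literature.Geometry.ComplexHyperbolic Literature.Geometry.ComplexHyperbolic.BallModel
open Literature.AlgebraicGeometry.ShimuraVarieties.BallForms
open Literature.NumberTheory.Automorphic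
open scoped ENNReal NNReal MatrixGroups Matrix ComplexConjugate

namespace Literature.NumberTheory.Rogawski1990

/-! ## §1 Inclusions and Lebesgue volumes -/

section Inclusions

/-- One squared entry is at most the Hilbert–Schmidt sum: `|g₂₂|² ≤ Σ_{ij} |g_{ij}|²`. [folklore] -/
private theorem sq_norm_apply_le_hs (M : Matrix (Fin 3) (Fin 3) ℂ) (a b : Fin 3) :
    ‖M a b‖ ^ 2 ≤ ∑ i : Fin 3, ∑ j : Fin 3, ‖M i j‖ ^ 2 := by
  calc ‖M a b‖ ^ 2 ≤ ∑ j : Fin 3, ‖M a j‖ ^ 2 :=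
        Finset.single_le_sum (f := fun j => ‖M a j‖ ^ 2) (fun j _ => by positivity) (Finset.mem_univ b)
    _ ≤ ∑ i : Fin 3, ∑ j : Fin 3, ‖M i j‖ ^ 2 :=
        Finset.single_le_sum (f := fun i => ∑ j : Fin 3, ‖M i j‖ ^ 2) (fun i _ => by positivity) (Finset.mem_univ a)

/-- **`{Σ|g_{ij}|² ≤ ρ} ⊆ π⁻¹{1 − |z|² ≥ ρ⁻¹}`**: if `Σ|g_{ij}|² ≤ ρ` then `1 − |g·x₀|² = |g₂₂|⁻² ≥ ρ⁻¹` (★ `one_sub_nsq_smul_x₀`).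
[cite: Rudin1980, §2.2 Thm. 2.2.6] -/
theorem inv_le_one_sub_nsq_smul_x₀_of_hs_le {g : U21} {ρ : ℝ}
    (h : ∑ i : Fin 3, ∑ j : Fin 3, ‖mat g i j‖ ^ 2 ≤ ρ) : ρ⁻¹ ≤ 1 - nsq (g • x₀).1 := by
  have h22 : ‖mat g 2 2‖ ^ 2 ≤ ρ := (sq_norm_apply_le_hs (mat g) 2 2).trans h
  have hpos : 0 < ‖mat g 2 2‖ ^ 2 := by
    have := one_le_norm_22 g
    positivity
  rw [one_sub_nsq_smul_x₀ g, inv_eq_one_div]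
  exact one_div_le_one_div_of_le hpos h22

/-- **In the hyperboloid chart**: if `ρ⁻¹ ≤ 1 − |chart W|² = (1 + |W|²)⁻¹` then `|W|² ≤ ρ` (indeed `1 + |W|² ≤ ρ`).
[cite: Rudin1980, §2.2] -/
theorem nsq_le_of_inv_le_one_sub_nsq_chart {ρ : ℝ} (hρ : 0 < ρ) {W : Fin 2 → ℂ}
    (h : ρ⁻¹ ≤ 1 - nsq (proj ![W 0, W 1, (Real.sqrt (1 + nsq W) : ℂ)] (Q_vecCons_sqrt_one_add_nsq_neg W)).1) :
    nsq W ≤ ρ := by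
  rw [coe_proj_vecCons_sqrt, one_sub_nsq_inv_sqrt_one_add_nsq_smul] at h
  have hpos : 0 < 1 + nsq W := by linarith [nsq_nonneg W]
  have h1 : 1 + nsq W ≤ ρ := (inv_le_inv₀ hρ hpos).1 h
  linarith [nsq_nonneg W]

/-- `{W ∣ |W|² ≤ s} ⊆ B̄(0, √s)` in the sup norm of `ℂ²` (`|W_i|² ≤ |W|²`). [folklore] -/
private theorem setOf_nsq_le_subset_closedBall (s : ℝ) :
    {W : Fin 2 → ℂ | nsq W ≤ s} ⊆ Metric.closedBall 0 (Real.sqrt s) := by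
  intro W hW
  rw [mem_closedBall_zero_iff, pi_norm_le_iff_of_nonneg (Real.sqrt_nonneg s)]
  intro i
  have hW' : nsq W ≤ s := hW
  have hi : ‖W i‖ ^ 2 ≤ s := by
    have h' : ‖W i‖ ^ 2 ≤ nsq W := by
      fin_cases i
      · show ‖W 0‖ ^ 2 ≤ nsq W
        unfold nsq
        linarith [sq_nonneg ‖W 1‖]
      · show ‖W 1‖ ^ 2 ≤ nsq W
        unfold nsq
        linarith [sq_nonneg ‖W 0‖]
    exact h'.trans hW'
  have := Real.abs_le_sqrt hi
  rwa [abs_of_nonneg (norm_nonneg _)] at this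

/-- `dim_ℝ ℂ² = 4`. [folklore] -/
private theorem finrank_real_fin_two_complex : Module.finrank ℝ (Fin 2 → ℂ) = 4 := by
  rw [Module.finrank_pi_fintype]
  simp [Complex.finrank_real_complex]

/-- **`vol_{ℂ²}{|W|² ≤ s} ≤ vol(B(0,1)) · s²`** for `s ≥ 0` (`Measure.addHaar_closedBall`, `dim_ℝ ℂ² = 4`, `√s⁴ = s²`). [folklore] -/
private theorem volume_setOf_nsq_le_le {s : ℝ} (hs : 0 ≤ s) :
    volume {W : Fin 2 → ℂ | nsq W ≤ s} ≤ ENNReal.ofReal (s ^ 2) * volume (Metric.ball (0 : Fin 2 → ℂ) 1) := by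
  refine (measure_mono (setOf_nsq_le_subset_closedBall s)).trans ?_
  rw [Measure.addHaar_closedBall volume (0 : Fin 2 → ℂ) (Real.sqrt_nonneg s), finrank_real_fin_two_complex]
  have h4 : Real.sqrt s ^ 4 = s ^ 2 := by
    rw [show (4 : ℕ) = 2 * 2 from rfl, pow_mul, Real.sq_sqrt hs]
  rw [h4]

end Inclusions

/-! ## §2 The theorem on the ball-model group `U21 = U(J)(ℂ)`, `J = diag(1,1,−1)` -/

section BallModelGroup

/-- **QUADRATIC GROWTH OF HAAR HS-BALLS IN `U(2,1)` (ball model)**: for every Haar measure `μ` on `U21` there is `C` with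
`μ {g ∣ Σ_{ij} |g_{ij}|² ≤ ρ} ≤ C ρ²` for all `ρ ≥ 1`.  Proof: `{Σ|g_{ij}|² ≤ ρ} ⊆ (g ↦ g·x₀)⁻¹{1−|z|² ≥ ρ⁻¹}`; `(g ↦ g·x₀)_* μ = c · β` (★ Helgason uniqueness);
`β = 9 · chart_* vol_{ℂ²}` (★ hyperboloid chart) and `chart⁻¹{1−|z|² ≥ ρ⁻¹} ⊆ {|W|² ≤ ρ} ⊆ B̄(0,√ρ)`, of Lebesgue volume `vol(B(0,1)) ρ²`.
[cite: BeuzartPlessis2020Asterisque, §1.5 (1.5.2)–(1.5.3) p. 31] [cite: Rudin1980, §2.2 Thm. 2.2.6] [cite: Helgason2000, Ch. I §1 No. 2, Thm. 1.9] -/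
theorem haar_U21_hsBall_le_quadratic (μ : Measure U21) [μ.IsHaarMeasure] :
    ∃ C : ℝ, ∀ ρ : ℝ, 1 ≤ ρ →
      μ {g : U21 | ∑ i : Fin 3, ∑ j : Fin 3, ‖mat g i j‖ ^ 2 ≤ ρ} ≤ ENNReal.ofReal (C * ρ ^ 2) := by
  obtain ⟨c, -, hct, hc⟩ := map_orbit_haar_eq_smul_bergmanVolume μ
  have hV : volume (Metric.ball (0 : Fin 2 → ℂ) 1) ≠ ∞ := measure_ball_lt_top.ne
  have hK : c * 9 * volume (Metric.ball (0 : Fin 2 → ℂ) 1) ≠ ∞ :=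
    ENNReal.mul_ne_top (ENNReal.mul_ne_top hct ENNReal.ofNat_ne_top) hV
  refine ⟨(c * 9 * volume (Metric.ball (0 : Fin 2 → ℂ) 1)).toReal, fun ρ hρ => ?_⟩
  have hρ0 : 0 < ρ := lt_of_lt_of_le one_pos hρ
  -- the target set on the ball and its measurability
  have hSm : MeasurableSet {z : Ball | ρ⁻¹ ≤ 1 - nsq z.1} :=
    measurableSet_le measurable_const (measurable_const.sub (continuous_fun_nsq.measurable.comp measurable_subtype_coe))
  -- (1) inclusion in the preimage under the orbit map
  have h1 : {g : U21 | ∑ i : Fin 3, ∑ j : Fin 3, ‖mat g i j‖ ^ 2 ≤ ρ} ⊆ (fun g : U21 => g • x₀) ⁻¹' {z : Ball | ρ⁻¹ ≤ 1 - nsq z.1} :=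
    fun g hg => inv_le_one_sub_nsq_smul_x₀_of_hs_le hg
  -- (2) push forward along the orbit map
  have horb : Continuous fun g : U21 => g • x₀ := continuous_id.smul continuous_const
  have h2 : μ ((fun g : U21 => g • x₀) ⁻¹' {z : Ball | ρ⁻¹ ≤ 1 - nsq z.1}) ≤ c * bergmanVolume {z : Ball | ρ⁻¹ ≤ 1 - nsq z.1} := by
    refine (le_map_apply horb.measurable.aemeasurable _).trans ?_
    rw [hc, Measure.smul_apply, smul_eq_mul]
  -- (3) the Bergman volume in the chart
  have hcm : Measurable fun W : Fin 2 → ℂ => proj ![W 0, W 1, (Real.sqrt (1 + nsq W) : ℂ)] (Q_vecCons_sqrt_one_add_nsq_neg W) :=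
    continuous_chart.measurable
  have h3 : bergmanVolume {z : Ball | ρ⁻¹ ≤ 1 - nsq z.1} ≤ 9 * (ENNReal.ofReal (ρ ^ 2) * volume (Metric.ball (0 : Fin 2 → ℂ) 1)) := by
    rw [bergmanVolume_eq_smul_map_chart, Measure.smul_apply, smul_eq_mul, Measure.map_apply hcm hSm]
    refine mul_le_mul' le_rfl ((measure_mono fun W hW => ?_).trans (volume_setOf_nsq_le_le hρ0.le))
    exact nsq_le_of_inv_le_one_sub_nsq_chart hρ0 hW
  -- (4) assemble
  calc μ {g : U21 | ∑ i : Fin 3, ∑ j : Fin 3, ‖mat g i j‖ ^ 2 ≤ ρ}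
      ≤ μ ((fun g : U21 => g • x₀) ⁻¹' {z : Ball | ρ⁻¹ ≤ 1 - nsq z.1}) := measure_mono h1
    _ ≤ c * (9 * (ENNReal.ofReal (ρ ^ 2) * volume (Metric.ball (0 : Fin 2 → ℂ) 1))) := h2.trans (mul_le_mul' le_rfl h3)
    _ = (c * 9 * volume (Metric.ball (0 : Fin 2 → ℂ) 1)) * ENNReal.ofReal (ρ ^ 2) := by ring
    _ = ENNReal.ofReal ((c * 9 * volume (Metric.ball (0 : Fin 2 → ℂ) 1)).toReal * ρ ^ 2) := by
        rw [ENNReal.ofReal_mul ENNReal.toReal_nonneg, ENNReal.ofReal_toReal hK]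

end BallModelGroup

/-! ## §3 Transport to the cell's carrier `U(Φ₃)(ℂ) = unitaryGroupOfForm (starRingEnd ℂ) Φ₃`, `Φ₃ = antidiag(1,1,1)` -/

section Transport

/-- `U21` IS `unitaryGroupOfForm (starRingEnd ℂ) J` — «`U(2,1) = {A : A* C A = C}`» (ball-model cell) and «`U(σ, J) = {g ∣ ᵗσ(g) J g = J}`» (Mok's notation, the
automorphic cell) are the same subgroup of `GL₃(ℂ)` (`gᴴ = (ḡ)ᵀ`). [cite: Jacobowitz1990, Ch. 2 §1 (p. 40)] [cite: Mok2014, §1 Notation p. 5] -/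
theorem mem_U21_iff_mem_unitaryGroupOfForm_J (g : GL (Fin 3) ℂ) :
    g ∈ U21 ↔ g ∈ unitaryGroupOfForm (starRingEnd ℂ) J := by
  rw [mem_unitaryGroupOfForm_iff]
  have h : ((g : Matrix (Fin 3) (Fin 3) ℂ).map (starRingEnd ℂ))ᵀ = (g : Matrix (Fin 3) (Fin 3) ℂ)ᴴ := by
    ext i j
    rfl
  rw [h]
  rfl

/-- **TRANSPORT ALONG A UNITARY CHANGE OF FORM**: if `T ∈ GL₃(ℂ)` is unitary (`Tᴴ T = 1`) and `Tᴴ J T = H`, then the quadratic HS-ball growth holds for every Haar measure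
on `U(H)(ℂ) = unitaryGroupOfForm (starRingEnd ℂ) H` (`g ↦ T g T⁻¹ : U(H) ≃ₜ* U(J) = U21` carries Haar to Haar and preserves `Σ|g_{ij}|²`, ★ `hs_unitary_conj`).
[cite: BeuzartPlessis2020Asterisque, §1.5 (1.5.2)–(1.5.3) p. 31] [cite: Helgason2000, Ch. I §1 No. 2, Thm. 1.9] -/
theorem haar_unitaryGroupOfForm_hsBall_le_of_unitary_formCongr {T : GL (Fin 3) ℂ} {H : Matrix (Fin 3) (Fin 3) ℂ}
    (hT : (T : Matrix (Fin 3) (Fin 3) ℂ)ᴴ * (T : Matrix (Fin 3) (Fin 3) ℂ) = 1)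
    (hH : (T : Matrix (Fin 3) (Fin 3) ℂ)ᴴ * J * (T : Matrix (Fin 3) (Fin 3) ℂ) = H)
    [MeasurableSpace ↥(unitaryGroupOfForm (starRingEnd ℂ) H)] [BorelSpace ↥(unitaryGroupOfForm (starRingEnd ℂ) H)]
    (ν : Measure ↥(unitaryGroupOfForm (starRingEnd ℂ) H)) [ν.IsHaarMeasure] :
    ∃ C : ℝ, ∀ ρ : ℝ, 1 ≤ ρ →
      ν {g | ∑ i : Fin 3, ∑ j : Fin 3, ‖((g : GL (Fin 3) ℂ) : Matrix (Fin 3) (Fin 3) ℂ) i j‖ ^ 2 ≤ ρ} ≤ ENNReal.ofReal (C * ρ ^ 2) := by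
  -- the conjugation isomorphism `U(H) ≃ₜ* U21`
  have hform : formCongr (starRingEnd ℂ) T J = H := by rw [formCongr_star, hH]
  have hmem : ∀ g : GL (Fin 3) ℂ, g ∈ unitaryGroupOfForm (starRingEnd ℂ) H ↔ GLn.conjEquiv T g ∈ U21 := fun g => by
    rw [GLn.conjEquiv_apply, mem_U21_iff_mem_unitaryGroupOfForm_J, conj_mem_unitaryGroupOfForm_iff, hform]
  obtain ⟨e, he⟩ : ∃ e : ↥(unitaryGroupOfForm (starRingEnd ℂ) H) ≃ₜ* ↥U21,
      ∀ g, mat (e g) = (T : Matrix (Fin 3) (Fin 3) ℂ) * ((g : GL (Fin 3) ℂ) : Matrix (Fin 3) (Fin 3) ℂ) * (T : Matrix (Fin 3) (Fin 3) ℂ)⁻¹ :=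
    ⟨ContinuousMulEquiv.restrictSubgroup (GLn.conjEquiv T) _ _ hmem, fun g => by
      show (((T * (g : GL (Fin 3) ℂ) * T⁻¹ : GL (Fin 3) ℂ)) : Matrix (Fin 3) (Fin 3) ℂ) = _
      rw [Units.val_mul, Units.val_mul, Matrix.coe_units_inv]⟩
  haveI : (ν.map e).IsHaarMeasure := e.isHaarMeasure_map ν
  have hme : MeasurableEmbedding e := e.toHomeomorph.measurableEmbedding
  obtain ⟨C, hC⟩ := haar_U21_hsBall_le_quadratic (ν.map e)
  refine ⟨C, fun ρ hρ => ?_⟩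
  -- the HS-ball of `U(H)` is the preimage of the HS-ball of `U21`
  have hpre : {g : ↥(unitaryGroupOfForm (starRingEnd ℂ) H) |
        ∑ i : Fin 3, ∑ j : Fin 3, ‖((g : GL (Fin 3) ℂ) : Matrix (Fin 3) (Fin 3) ℂ) i j‖ ^ 2 ≤ ρ} =
      e ⁻¹' {g : U21 | ∑ i : Fin 3, ∑ j : Fin 3, ‖mat g i j‖ ^ 2 ≤ ρ} := by
    ext g
    simp only [mem_setOf_eq, mem_preimage]
    rw [he g, hs_unitary_conj hT]
  rw [hpre, ← hme.map_apply]
  exact hC ρ hρ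

/-- The Sylvester matrix `T = 2^{-1∕2}(1,0,1; 0,√2,0; 1,0,−1)` is unitary: `Tᴴ T = 1`. [folklore] -/
private theorem conjTranspose_mul_self_sylvesterT :
    (!![((Real.sqrt 2)⁻¹ : ℂ), 0, ((Real.sqrt 2)⁻¹ : ℂ); 0, 1, 0; ((Real.sqrt 2)⁻¹ : ℂ), 0, -((Real.sqrt 2)⁻¹ : ℂ)] : Matrix (Fin 3) (Fin 3) ℂ)ᴴ *
      !![((Real.sqrt 2)⁻¹ : ℂ), 0, ((Real.sqrt 2)⁻¹ : ℂ); 0, 1, 0; ((Real.sqrt 2)⁻¹ : ℂ), 0, -((Real.sqrt 2)⁻¹ : ℂ)] = 1 := by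
  have hsq : ((Real.sqrt 2 : ℝ) : ℂ) ^ 2 = 2 := by
    rw [← Complex.ofReal_pow, Real.sq_sqrt (by norm_num : (0 : ℝ) ≤ 2)]
    push_cast
    rfl
  have hstar : (starRingEnd ℂ) ((Real.sqrt 2)⁻¹ : ℂ) = ((Real.sqrt 2)⁻¹ : ℂ) := by
    rw [← Complex.ofReal_inv, Complex.conj_ofReal]
  ext i j
  fin_cases i <;> fin_cases j <;>
    simp [Matrix.conjTranspose, Matrix.mul_apply, Fin.sum_univ_three, hstar, ← pow_two, hsq] <;> norm_num

/-- The Sylvester datum: `Tᴴ J T = Φ₃ = antidiag(1,1,1)` for `T = 2^{-1∕2}(1,0,1; 0,√2,0; 1,0,−1)`, `J = diag(1,1,−1)`. [folklore] -/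
private theorem conjTranspose_sylvesterT_mul_J_mul :
    (!![((Real.sqrt 2)⁻¹ : ℂ), 0, ((Real.sqrt 2)⁻¹ : ℂ); 0, 1, 0; ((Real.sqrt 2)⁻¹ : ℂ), 0, -((Real.sqrt 2)⁻¹ : ℂ)] : Matrix (Fin 3) (Fin 3) ℂ)ᴴ * J *
      !![((Real.sqrt 2)⁻¹ : ℂ), 0, ((Real.sqrt 2)⁻¹ : ℂ); 0, 1, 0; ((Real.sqrt 2)⁻¹ : ℂ), 0, -((Real.sqrt 2)⁻¹ : ℂ)] =
      Matrix.of fun i j : Fin 3 => if i.val + j.val + 1 = 3 then (1 : ℂ) else 0 := by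
  have hsq : ((Real.sqrt 2 : ℝ) : ℂ) ^ 2 = 2 := by
    rw [← Complex.ofReal_pow, Real.sq_sqrt (by norm_num : (0 : ℝ) ≤ 2)]
    push_cast
    rfl
  have hstar : (starRingEnd ℂ) ((Real.sqrt 2)⁻¹ : ℂ) = ((Real.sqrt 2)⁻¹ : ℂ) := by
    rw [← Complex.ofReal_inv, Complex.conj_ofReal]
  ext i j
  fin_cases i <;> fin_cases j <;>
    simp [Matrix.conjTranspose, Matrix.mul_apply, Fin.sum_univ_three, hstar, J, Matrix.diagonal, ← pow_two, hsq] <;> norm_num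

/-- **There is a unitary `T ∈ GL₃(ℂ)` with `Tᴴ J T = Φ₃`** — the Sylvester datum between `U(2,1)`'s two standard forms `diag(1,1,−1)` and `antidiag(1,1,1)`
(witness `T = 2^{-1∕2}(1,0,1; 0,√2,0; 1,0,−1)`, real orthogonal); isometric forms have conjugate unitary groups. [cite: PlatonovRapinchuk1994, §2.3] -/
theorem exists_unitary_formCongr_J_eq_antidiag_three :
    ∃ T : GL (Fin 3) ℂ, (T : Matrix (Fin 3) (Fin 3) ℂ)ᴴ * (T : Matrix (Fin 3) (Fin 3) ℂ) = 1 ∧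
      (T : Matrix (Fin 3) (Fin 3) ℂ)ᴴ * J * (T : Matrix (Fin 3) (Fin 3) ℂ) = Matrix.of fun i j : Fin 3 => if i.val + j.val + 1 = 3 then (1 : ℂ) else 0 := by
  have hU := conjTranspose_mul_self_sylvesterT
  have hunit : IsUnit (!![((Real.sqrt 2)⁻¹ : ℂ), 0, ((Real.sqrt 2)⁻¹ : ℂ); 0, 1, 0; ((Real.sqrt 2)⁻¹ : ℂ), 0, -((Real.sqrt 2)⁻¹ : ℂ)] : Matrix (Fin 3) (Fin 3) ℂ) :=
    (Matrix.isUnit_iff_isUnit_det _).2 (Matrix.isUnit_det_of_left_inverse hU)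
  refine ⟨hunit.unit, ?_, ?_⟩
  · rw [IsUnit.unit_spec]
    exact hU
  · rw [IsUnit.unit_spec]
    exact conjTranspose_sylvesterT_mul_J_mul

/-- **(T3-out-G) — QUADRATIC GROWTH OF THE HAAR VOLUME OF HILBERT–SCHMIDT BALLS IN `U(2,1) = U(Φ₃)(ℂ)`, UNCONDITIONAL**, in the token shape of ★ (T2-out)
`haar_unitaryGroupOfForm_antidiag_two_hsBall_le_linear`: for every Haar measure `ν` on `unitaryGroupOfForm (starRingEnd ℂ) Φ₃` (`Φ₃ = Matrix.of (i+j+1 = 3)`) there is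
`C` with `ν {g ∣ Σ_{ij} |g_{ij}|² ≤ ρ} ≤ C ρ²` for all `ρ ≥ 1` — Harish-Chandra's polynomial growth of balls for the real-rank-one group `U(2,1)` at the Schwartz scale
`e = 1` of ★ `ArchSchwartzOn L 3 Φ₃ 1`. [cite: BeuzartPlessis2020Asterisque, §1.5 (1.5.2)–(1.5.3) p. 31] [cite: Rudin1980, §2.2 Thm. 2.2.6] [cite: Helgason2000, Ch. I §1 No. 2, Thm. 1.9] -/
theorem haar_unitaryGroupOfForm_antidiag_three_hsBall_le_quadratic
    [MeasurableSpace ↥(unitaryGroupOfForm (starRingEnd ℂ) (Matrix.of fun i j : Fin 3 => if i.val + j.val + 1 = 3 then (1 : ℂ) else 0))]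
    [BorelSpace ↥(unitaryGroupOfForm (starRingEnd ℂ) (Matrix.of fun i j : Fin 3 => if i.val + j.val + 1 = 3 then (1 : ℂ) else 0))]
    (ν : Measure ↥(unitaryGroupOfForm (starRingEnd ℂ) (Matrix.of fun i j : Fin 3 => if i.val + j.val + 1 = 3 then (1 : ℂ) else 0))) [ν.IsHaarMeasure] :
    ∃ C : ℝ, ∀ ρ : ℝ, 1 ≤ ρ →
      ν {g | ∑ i : Fin 3, ∑ j : Fin 3, ‖((g : GL (Fin 3) ℂ) : Matrix (Fin 3) (Fin 3) ℂ) i j‖ ^ 2 ≤ ρ} ≤ ENNReal.ofReal (C * ρ ^ 2) := by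
  obtain ⟨T, hT, hH⟩ := exists_unitary_formCongr_J_eq_antidiag_three
  exact haar_unitaryGroupOfForm_hsBall_le_of_unitary_formCongr hT hH ν

end Transport

end Literature.NumberTheory.Rogawski1990

end
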